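import Summits.AtomisticToContinuum.HydrodynamicLimit.Theorems.AntiMazurCoboundariesCorrectorPressureDecayTangentBiasTorus
import Summits.AtomisticToContinuum.HydrodynamicLimit.Theorems.AntiMazurCoboundariesCorrectorPressureDecayTangentTightnessLaplace
import Mathlib.MeasureTheory.Measure.Count
import Mathlib.MeasureTheory.Measure.Regular

/-!
# Bias continuity along tangent states: the Campbell (intensity) bound of a tangent state

Helper file of crux stmt-AtomisticToContinuum-14135 `AntiMazurCoboundaries.CorrectorPressureDecay`, line `FirstLemma`
(idea `kifer-compactification`), registered stub `stub_campbellBound`; namespace `…Theorems.KiferCompactification`.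
For a tangent state `μ` along `ι` satisfying the one-body limit on `C_c⁺` (a HYPOTHESIS here), if the laws `Q (ι k)`
put normalised mass `≤ δ` on velocities of norm `> R`, uniformly in `k`, then for every measurable `S ⊆ ℝ³`:
`E_μ[#{p ∈ ω : p.1 ∈ S, R < ‖p.2‖}] ≤ (∫φ)⁻¹ σ³ δ · vol(S)` (Olla–Varadhan–Yau 1993 §4 (A)). Route:
* finite `N` (`integral_labelSum_le_campbell`): for `0 ≤ h ≤ ψ ⊗ 1_{R < ‖v‖}`, `ψ ∈ C_c⁺(ℝ³)`, Fubini and the torus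
  Campbell bound `∫_{𝕋³} ψ(ε⁻¹reprSym(q − x)) dx ≤ ε³ ∫ψ` (`integral_comp_blowUp_le`) give
  `∫ φ(x) E_Q[Σᵢ h(blowUpPoint ε x zᵢ)] dx ≤ ε³ (∫ψ) E_Q[#{i : R < ‖vᵢ‖}] ≤ σ³ δ ∫ψ` (`(N+1)ε³ = σ³`);
* `N = ∞`: pass to the limit (`integral_sumFn_le_campbell`); count compact boxes `K₁ × K₂ ⊆ U × {R < ‖v‖}` by Urysohn
  minorants (`lintegral_count_compact_prod_le_campbell`), open boxes by monotone convergence along compact exhaustions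
  (`lintegral_count_iUnion_campbell`, `lintegral_count_open_prod_le_campbell`), measurable `S` by outer regularity.
-/

noncomputable section

open MeasureTheory ProbabilityTheory Set Filter Topology
open scoped ENNReal

namespace Summit.AtomisticToContinuum.HydrodynamicLimit.Theorems.KiferCompactification

open Literature.MathematicalPhysics.KineticTheory (T3 V3 hsDiameter blowUpPoint hsDiameter_pos
  succ_mul_hsDiameter_pow_three)
open Literature.Analysis.FluidPDE (HardSphereFlow Config)
open Literature.Analysis.FluidPDE.Torus (reprSym measurable_reprSym)
open Literature.Analysis.FunctionSpaces (PointConfig)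

/-! ## The finite-`N` Campbell estimate for dominated test functions -/

/-- The velocity tail set `{R < ‖v‖}` is measurable. -/
private theorem measurableSet_tail (R : ℝ) : MeasurableSet {v : V3 | R < ‖v‖} :=
  measurableSet_lt measurable_const measurable_norm

/-- Bounded measurable real functions on a finite measure space are integrable. -/
private theorem integrable_of_abs_le_campbell {α : Type*} [MeasurableSpace α] {μ : Measure α} [IsFiniteMeasure μ]
    {f : α → ℝ} (hfm : Measurable f) {C : ℝ} (hfC : ∀ x, |f x| ≤ C) : Integrable f μ :=
  Integrable.of_bound hfm.aestronglyMeasurable C (ae_of_all _ fun x => by rw [Real.norm_eq_abs]; exact hfC x)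

/-- **Finite-`N` Campbell estimate.** For a probability law `Q` on `n`-particle torus phase space, a measurable weight
`0 ≤ φ ≤ 1`, a measurable `h ≥ 0` on `ℝ³ × ℝ³` dominated by `ψ ⊗ 1_{R < ‖v‖}` with `ψ ∈ C_c⁺(ℝ³)`, and a scale
`ε > 0`: `∫ φ(x) E_Q[Σᵢ h(blowUpPoint ε x zᵢ)] dx ≤ ε³ (∫ψ) E_Q[#{i : R < ‖vᵢ‖}]` (Fubini and the torus Campbell
bound `integral_comp_blowUp_le`). -/
theorem integral_labelSum_le_campbell {n : ℕ} (Q : Measure (Config n (Fin 3) T3)) [IsProbabilityMeasure Q]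
    {φ : T3 → ℝ} (hφm : Measurable φ) (hφ0 : ∀ x, 0 ≤ φ x) (hφ1 : ∀ x, φ x ≤ 1)
    {h : V3 × V3 → ℝ} (hhm : Measurable h) (hh0 : ∀ p, 0 ≤ h p)
    {ψ : V3 → ℝ} (hψ : Continuous ψ) (hψcs : HasCompactSupport ψ) (hψ0 : ∀ y, 0 ≤ ψ y) {R : ℝ}
    (hle : ∀ p, h p ≤ ψ p.1 * ({v : V3 | R < ‖v‖}).indicator (fun _ => (1 : ℝ)) p.2) {ε : ℝ} (hε : 0 < ε) :
    ∫ x : T3, φ x * ∫ z, (∑ i, h (blowUpPoint ε x (z i))) ∂Q ≤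
      ε ^ 3 * (∫ y, ψ y) * ∫ z, (∑ i, ({v : V3 | R < ‖v‖}).indicator (fun _ => (1 : ℝ)) (z i).2) ∂Q := by
  obtain ⟨B, hB⟩ := hψ.bounded_above_of_compact_support hψcs
  have hB0 : 0 ≤ B := (norm_nonneg _).trans (hB 0)
  set V : Set V3 := {v : V3 | R < ‖v‖} with hV
  have hVm : MeasurableSet V := measurableSet_tail R
  have hind0 : ∀ v, 0 ≤ V.indicator (fun _ => (1 : ℝ)) v := fun v =>
    Set.indicator_nonneg (fun _ _ => zero_le_one) v
  have hind1 : ∀ v, V.indicator (fun _ => (1 : ℝ)) v ≤ 1 := fun v =>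
    Set.indicator_le_self' (fun _ _ => zero_le_one) v
  -- the dominating function `g = ψ ⊗ 1_V` and the bound `h ≤ g ≤ B`
  set g : V3 × V3 → ℝ := fun p => ψ p.1 * V.indicator (fun _ => (1 : ℝ)) p.2 with hg
  have hgm : Measurable g :=
    (hψ.measurable.comp measurable_fst).mul ((measurable_const.indicator hVm).comp measurable_snd)
  have hgB : ∀ p, g p ≤ B := fun p => (mul_le_mul (le_trans (le_abs_self _)
    (by rw [← Real.norm_eq_abs]; exact hB _)) (hind1 _) (hind0 _) hB0).trans_eq (mul_one B)
  have hhB : ∀ p, |h p| ≤ B := fun p => by rw [abs_of_nonneg (hh0 p)]; exact (hle p).trans (hgB p)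
  have hgabs : ∀ p, |g p| ≤ B := fun p => by rw [abs_of_nonneg (mul_nonneg (hψ0 _) (hind0 _))]; exact hgB p
  -- the two joint integrands
  set F : T3 × Config n (Fin 3) T3 → ℝ := fun p => φ p.1 * ∑ i, h (blowUpPoint ε p.1 (p.2 i)) with hF
  set G : T3 × Config n (Fin 3) T3 → ℝ := fun p => ∑ i, g (blowUpPoint ε p.1 (p.2 i)) with hG
  have hFm : Measurable F := (hφm.comp measurable_fst).mul (measurable_labelSum hhm)
  have hGm : Measurable G := measurable_labelSum hgm
  have hsum_le : ∀ (u : V3 × V3 → ℝ), (∀ p, |u p| ≤ B) → ∀ (x : T3) (z : Config n (Fin 3) T3),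
      |∑ i, u (blowUpPoint ε x (z i))| ≤ n * B := by
    intro u hu x z
    calc |∑ i, u (blowUpPoint ε x (z i))| ≤ ∑ i, |u (blowUpPoint ε x (z i))| := Finset.abs_sum_le_sum_abs _ _
      _ ≤ ∑ _i : Fin n, B := Finset.sum_le_sum fun i _ => hu _
      _ = n * B := by simp
  have hFb : ∀ p, |F p| ≤ n * B := by
    rintro ⟨x, z⟩
    simp only [hF, abs_mul]
    calc |φ x| * |∑ i, h (blowUpPoint ε x (z i))| ≤ 1 * (n * B) :=
        mul_le_mul (abs_le.2 ⟨by linarith [hφ0 x], hφ1 x⟩) (hsum_le h hhB x z) (abs_nonneg _) zero_le_one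
      _ = n * B := one_mul _
  have hGb : ∀ p, |G p| ≤ n * B := fun p => hsum_le g hgabs p.1 p.2
  have hFi : Integrable F ((volume : Measure T3).prod Q) := integrable_of_abs_le_campbell hFm hFb
  have hGi : Integrable G ((volume : Measure T3).prod Q) := integrable_of_abs_le_campbell hGm hGb
  -- pointwise domination `F ≤ G`
  have hFG : ∀ p, F p ≤ G p := by
    rintro ⟨x, z⟩
    simp only [hF, hG]
    calc φ x * ∑ i, h (blowUpPoint ε x (z i)) ≤ 1 * ∑ i, h (blowUpPoint ε x (z i)) :=
        mul_le_mul_of_nonneg_right (hφ1 x) (Finset.sum_nonneg fun i _ => hh0 _)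
      _ = ∑ i, h (blowUpPoint ε x (z i)) := one_mul _
      _ ≤ ∑ i, g (blowUpPoint ε x (z i)) := Finset.sum_le_sum fun i _ => hle _
  -- step 1: the left-hand side is the product integral of `F`, at most that of `G`
  have h1 : ∫ x : T3, φ x * ∫ z, (∑ i, h (blowUpPoint ε x (z i))) ∂Q =
      ∫ p, F p ∂((volume : Measure T3).prod Q) := by
    rw [integral_prod F hFi]
    refine integral_congr_ae (ae_of_all _ fun x => ?_)
    simp only [hF]
    exact (integral_const_mul _ _).symm
  have h2 : ∫ p, F p ∂((volume : Measure T3).prod Q) ≤ ∫ p, G p ∂((volume : Measure T3).prod Q) :=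
    integral_mono hFi hGi hFG
  -- step 2: Fubini for `G` and the torus Campbell bound particle by particle
  have h3 : ∫ p, G p ∂((volume : Measure T3).prod Q) = ∫ z, (∫ x : T3, G (x, z)) ∂Q :=
    integral_prod_symm G hGi
  have hinner : ∀ z : Config n (Fin 3) T3, ∫ x : T3, G (x, z) ≤
      ∑ i, (ε ^ 3 * ∫ y, ψ y) * V.indicator (fun _ => (1 : ℝ)) (z i).2 := by
    intro z
    have hGz : (fun x : T3 => G (x, z)) =
        fun x => ∑ i, ψ (ε⁻¹ • reprSym ((z i).1 - x)) * V.indicator (fun _ => (1 : ℝ)) (z i).2 := by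
      funext x
      simp only [hG, hg, blowUpPoint]
    rw [hGz, integral_finsetSum _ fun i _ => ?_]
    · refine Finset.sum_le_sum fun i _ => ?_
      rw [integral_mul_const]
      exact mul_le_mul_of_nonneg_right (integral_comp_blowUp_le hψ hψcs hψ0 hε (z i).1) (hind0 _)
    · have hm : Measurable fun x : T3 => ψ (ε⁻¹ • reprSym ((z i).1 - x)) :=
        hψ.measurable.comp ((measurable_const_smul ε⁻¹).comp
          (measurable_reprSym.comp (measurable_const.sub measurable_id)))
      refine integrable_of_abs_le_campbell (hm.mul_const _) (C := B) fun x => ?_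
      exact hgabs (ε⁻¹ • reprSym ((z i).1 - x), (z i).2)
  have h4 : ∫ z, (∫ x : T3, G (x, z)) ∂Q ≤
      ∫ z, (∑ i, (ε ^ 3 * ∫ y, ψ y) * V.indicator (fun _ => (1 : ℝ)) (z i).2) ∂Q := by
    refine integral_mono hGi.integral_prod_right ?_ hinner
    refine integrable_of_abs_le_campbell (Finset.measurable_sum _ fun i _ =>
      ((measurable_const.indicator hVm).comp (measurable_pi_apply i).snd).const_mul _)
      (C := n * (|ε ^ 3 * ∫ y, ψ y| * 1)) fun z => ?_
    calc |∑ i, (ε ^ 3 * ∫ y, ψ y) * V.indicator (fun _ => (1 : ℝ)) (z i).2|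
        ≤ ∑ i, |(ε ^ 3 * ∫ y, ψ y) * V.indicator (fun _ => (1 : ℝ)) (z i).2| := Finset.abs_sum_le_sum_abs _ _
      _ ≤ ∑ _i : Fin n, |ε ^ 3 * ∫ y, ψ y| * 1 := Finset.sum_le_sum fun i _ => by
          rw [abs_mul]
          exact mul_le_mul_of_nonneg_left (by rw [abs_of_nonneg (hind0 _)]; exact hind1 _) (abs_nonneg _)
      _ = n * (|ε ^ 3 * ∫ y, ψ y| * 1) := by simp
  have h5 : ∫ z, (∑ i, (ε ^ 3 * ∫ y, ψ y) * V.indicator (fun _ => (1 : ℝ)) (z i).2) ∂Q =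
      ε ^ 3 * (∫ y, ψ y) * ∫ z, (∑ i, V.indicator (fun _ => (1 : ℝ)) (z i).2) ∂Q := by
    rw [← integral_const_mul (ε ^ 3 * ∫ y, ψ y)]
    refine integral_congr_ae (ae_of_all _ fun z => ?_)
    simp only [Finset.mul_sum]
  exact h1.trans_le (h2.trans (h3.trans_le (h4.trans_eq h5)))

/-- **Campbell bound for dominated statistics in the limit.** If the one-body functionals of a measurable `h ≥ 0`
dominated by `ψ ⊗ 1_{R < ‖v‖}` (`ψ ∈ C_c⁺(ℝ³)`) converge along `ι` to `E_μ[Σ_{p ∈ ω} h p]`, and the probability laws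
`Q (ι k)` put normalised mass `≤ δ` on velocities of norm `> R`, then `E_μ[Σ_{p ∈ ω} h p] ≤ (∫φ)⁻¹ σ³ δ ∫ψ`
(`integral_labelSum_le_campbell` and `(N+1) ε_N³ = σ³`, term by term along the sequence). -/
theorem integral_sumFn_le_campbell {σ : ℝ} (hσ : 0 < σ) {φ : T3 → ℝ} (hφ : Continuous φ) (hφ0 : ∀ x, 0 ≤ φ x)
    (hφ1 : ∀ x, φ x ≤ 1) (hφi : 0 < ∫ x, φ x) {N : ℕ → ℕ} (Q : ∀ k, Measure (Config (N k + 1) (Fin 3) T3))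
    (hQ : ∀ k, IsProbabilityMeasure (Q k)) (ι : ℕ → ℕ) (μ : Measure (PointConfig (V3 × V3)))
    {h : V3 × V3 → ℝ} (hhm : Measurable h) (hh0 : ∀ p, 0 ≤ h p)
    (hlim : Tendsto (fun k => (∫ x, φ x)⁻¹ * ∫ x : T3, φ x *
        ∫ z, (∑ i, h (blowUpPoint (hsDiameter σ (N (ι k))) x (z i))) ∂Q (ι k)) atTop
      (𝓝 (∫ ω, ω.sumFn h ∂μ)))
    {ψ : V3 → ℝ} (hψ : Continuous ψ) (hψcs : HasCompactSupport ψ) (hψ0 : ∀ y, 0 ≤ ψ y) {R : ℝ}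
    (hle : ∀ p, h p ≤ ψ p.1 * ({v : V3 | R < ‖v‖}).indicator (fun _ => (1 : ℝ)) p.2) {δ : ℝ}
    (htail : ∀ k, ((N (ι k) + 1 : ℕ) : ℝ)⁻¹ *
      ∫ z, (∑ i, ({v : V3 | R < ‖v‖}).indicator (fun _ => (1 : ℝ)) (z i).2) ∂Q (ι k) ≤ δ) :
    ∫ ω, ω.sumFn h ∂μ ≤ (∫ x, φ x)⁻¹ * σ ^ 3 * δ * ∫ y, ψ y := by
  refine le_of_tendsto' hlim fun k => ?_
  haveI := hQ (ι k)
  have he : 0 < hsDiameter σ (N (ι k)) := hsDiameter_pos hσ _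
  have h1 := integral_labelSum_le_campbell (Q (ι k)) hφ.measurable hφ0 hφ1 hhm hh0 hψ hψcs hψ0 hle he
  have hN : (0 : ℝ) < ((N (ι k) + 1 : ℕ) : ℝ) := by positivity
  have h2 : ∫ z, (∑ i, ({v : V3 | R < ‖v‖}).indicator (fun _ => (1 : ℝ)) (z i).2) ∂Q (ι k) ≤
      ((N (ι k) + 1 : ℕ) : ℝ) * δ := by
    have h := htail k
    rwa [inv_mul_le_iff₀ hN] at h
  have h3 : ((N (ι k) + 1 : ℕ) : ℝ) * hsDiameter σ (N (ι k)) ^ 3 = σ ^ 3 :=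
    succ_mul_hsDiameter_pow_three σ (N (ι k))
  have hψi : 0 ≤ ∫ y, ψ y := integral_nonneg hψ0
  calc (∫ x, φ x)⁻¹ * ∫ x : T3, φ x *
        ∫ z, (∑ i, h (blowUpPoint (hsDiameter σ (N (ι k))) x (z i))) ∂Q (ι k)
      ≤ (∫ x, φ x)⁻¹ * (hsDiameter σ (N (ι k)) ^ 3 * (∫ y, ψ y) * (((N (ι k) + 1 : ℕ) : ℝ) * δ)) := by
        refine mul_le_mul_of_nonneg_left (h1.trans ?_) (inv_nonneg.2 hφi.le)
        exact mul_le_mul_of_nonneg_left h2 (mul_nonneg (pow_nonneg he.le 3) hψi)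
    _ = (∫ x, φ x)⁻¹ * (((N (ι k) + 1 : ℕ) : ℝ) * hsDiameter σ (N (ι k)) ^ 3) * δ * ∫ y, ψ y := by ring
    _ = (∫ x, φ x)⁻¹ * σ ^ 3 * δ * ∫ y, ψ y := by rw [h3]

/-! ## Counting points: sets versus test functions -/

/-- A nonnegative compactly supported test function which is `≥ 1` on a compact set `K` counts at least the points of
a configuration in `K`. -/
theorem toENNReal_count_le_ofReal_sumFn (ω : PointConfig (V3 × V3)) {K : Set (V3 × V3)} (hK : IsCompact K)
    {h : V3 × V3 → ℝ} (hcs : HasCompactSupport h) (hh0 : ∀ p, 0 ≤ h p) (hK1 : ∀ p ∈ K, 1 ≤ h p) :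
    ((ω.count K : ℕ∞) : ℝ≥0∞) ≤ ENNReal.ofReal (ω.sumFn h) := by
  have hfin : (ω.carrier ∩ K).Finite := ω.finite_inter_isCompact K hK
  rw [PointConfig.count, hfin.encard_eq_coe_toFinset_card, ENat.toENNReal_coe, ← ENNReal.ofReal_natCast]
  refine ENNReal.ofReal_le_ofReal ?_
  rw [ω.sumFn_eq_sum hcs]
  calc ((hfin.toFinset.card : ℕ) : ℝ) = ∑ _p ∈ hfin.toFinset, (1 : ℝ) := by simp
    _ ≤ ∑ p ∈ hfin.toFinset, h p := Finset.sum_le_sum fun p hp => hK1 p (hfin.mem_toFinset.1 hp).2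
    _ ≤ ∑ p ∈ (ω.finite_inter_support hcs).toFinset, h p := by
        refine Finset.sum_le_sum_of_subset_of_nonneg (fun p hp => ?_) fun p _ _ => hh0 p
        rw [Set.Finite.mem_toFinset] at hp ⊢
        exact ⟨hp.1, fun h0 => absurd (hK1 p hp.2) (by rw [h0]; norm_num)⟩

/-- Along an increasing sequence of sets the extended cardinalities increase to that of the union (continuity from
below of the counting measure). -/
private theorem toENNReal_encard_iUnion {α : Type*} {A : ℕ → Set α} (hA : Monotone A) :
    (((⋃ n, A n).encard : ℕ∞) : ℝ≥0∞) = ⨆ n, (((A n).encard : ℕ∞) : ℝ≥0∞) := by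
  letI : MeasurableSpace α := ⊤
  have h : ∀ s : Set α, ((s.encard : ℕ∞) : ℝ≥0∞) = Measure.count s := fun s =>
    (Measure.count_apply MeasurableSpace.measurableSet_top).symm
  simp only [h]
  exact hA.measure_iUnion

/-- The counting maps are measurable into `ℝ≥0∞`. -/
private theorem measurable_toENNReal_count {s : Set (V3 × V3)} (hs : MeasurableSet s) :
    Measurable fun ω : PointConfig (V3 × V3) => ((ω.count s : ℕ∞) : ℝ≥0∞) :=
  measurable_from_top.comp (PointConfig.measurable_count hs)

/-- **Monotone convergence of mean counts.** Along an increasing sequence of measurable sets `A n ⊆ ℝ³ × ℝ³`,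
`E_μ[#(ω ∩ ⋃ₙ Aₙ)] = supₙ E_μ[#(ω ∩ Aₙ)]`. -/
theorem lintegral_count_iUnion_campbell (μ : Measure (PointConfig (V3 × V3))) {A : ℕ → Set (V3 × V3)}
    (hAm : ∀ n, MeasurableSet (A n)) (hA : Monotone A) :
    ∫⁻ ω, ((ω.count (⋃ n, A n) : ℕ∞) : ℝ≥0∞) ∂μ = ⨆ n, ∫⁻ ω, ((ω.count (A n) : ℕ∞) : ℝ≥0∞) ∂μ := by
  have hpt : ∀ ω : PointConfig (V3 × V3),
      ((ω.count (⋃ n, A n) : ℕ∞) : ℝ≥0∞) = ⨆ n, ((ω.count (A n) : ℕ∞) : ℝ≥0∞) := by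
    intro ω
    simp only [PointConfig.count, Set.inter_iUnion]
    exact toENNReal_encard_iUnion fun m n hmn => Set.inter_subset_inter_right _ (hA hmn)
  simp only [hpt]
  exact lintegral_iSup (fun n => measurable_toENNReal_count (hAm n)) fun m n hmn ω =>
    ENat.toENNReal_le.2 (ω.count_mono (hA hmn))

/-- Bounded pieces of an increasing exhaustion still exhaust. -/
private theorem iUnion_inter_closedBall_eq {F : ℕ → Set V3} (hF : Monotone F) :
    ⋃ n, (F n ∩ Metric.closedBall (0 : V3) n) = ⋃ n, F n := by
  refine Subset.antisymm (iUnion_mono fun n => inter_subset_left) fun x hx => ?_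
  obtain ⟨m, hm⟩ := mem_iUnion.1 hx
  obtain ⟨k, hk⟩ := exists_nat_ge ‖x‖
  refine mem_iUnion.2 ⟨max m k, hF (le_max_left _ _) hm, ?_⟩
  rw [Metric.mem_closedBall, dist_zero_right]
  exact hk.trans (by exact_mod_cast le_max_right m k)

/-- Bounded pieces of an increasing sequence increase. -/
private theorem monotone_inter_closedBall {F : ℕ → Set V3} (hF : Monotone F) :
    Monotone fun n : ℕ => F n ∩ Metric.closedBall (0 : V3) n := fun _ _ hmn =>
  inter_subset_inter (hF hmn) (Metric.closedBall_subset_closedBall (by exact_mod_cast hmn))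

/-! ## The Campbell bound of a tangent state -/

/-- **Campbell bound on compact boxes.** Under the one-body limit on `C_c⁺` and the velocity-tail hypothesis, for
compact `K₁ ⊆ U` (`U` open) and compact `K₂ ⊆ {R < ‖v‖}`:
`E_μ[#(ω ∩ K₁ × K₂)] ≤ (∫φ)⁻¹ σ³ δ · vol(U)` — count `K₁ × K₂` by the Urysohn minorant `ψ ⊗ η`
(`1_{K₁} ≤ ψ ≤ 1_U`, `1_{K₂} ≤ η ≤ 1_{R < ‖v‖}`) and apply `integral_sumFn_le_campbell`, `∫ψ ≤ vol U`. -/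
theorem lintegral_count_compact_prod_le_campbell {σ : ℝ} (hσ : 0 < σ) {φ : T3 → ℝ} (hφ : Continuous φ)
    (hφ0 : ∀ x, 0 ≤ φ x) (hφ1 : ∀ x, φ x ≤ 1) (hφi : 0 < ∫ x, φ x) {N : ℕ → ℕ}
    (Q : ∀ k, Measure (Config (N k + 1) (Fin 3) T3)) (hQ : ∀ k, IsProbabilityMeasure (Q k)) (ι : ℕ → ℕ)
    (μ : Measure (PointConfig (V3 × V3)))
    (hone : ∀ (h : V3 × V3 → ℝ), Continuous h → HasCompactSupport h → (∀ p, 0 ≤ h p) →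
      Integrable (fun ω : PointConfig (V3 × V3) => ω.sumFn h) μ ∧
      Tendsto (fun k => (∫ x, φ x)⁻¹ * ∫ x : T3, φ x *
          ∫ z, (∑ i, h (blowUpPoint (hsDiameter σ (N (ι k))) x (z i))) ∂Q (ι k)) atTop
        (𝓝 (∫ ω, ω.sumFn h ∂μ)))
    {R δ : ℝ} (hδ : 0 ≤ δ)
    (htail : ∀ k, ((N (ι k) + 1 : ℕ) : ℝ)⁻¹ *
      ∫ z, (∑ i, ({v : V3 | R < ‖v‖}).indicator (fun _ => (1 : ℝ)) (z i).2) ∂Q (ι k) ≤ δ)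
    {K₁ U : Set V3} (hK₁ : IsCompact K₁) (hU : IsOpen U) (hK₁U : K₁ ⊆ U) {K₂ : Set V3} (hK₂ : IsCompact K₂)
    (hK₂R : K₂ ⊆ {v : V3 | R < ‖v‖}) :
    ∫⁻ ω, ((ω.count (K₁ ×ˢ K₂) : ℕ∞) : ℝ≥0∞) ∂μ ≤ ENNReal.ofReal ((∫ x, φ x)⁻¹ * σ ^ 3 * δ) * volume U := by
  have hVc : IsClosed {v : V3 | R < ‖v‖}ᶜ := (isOpen_lt continuous_const continuous_norm).isClosed_compl
  obtain ⟨f, hf1, hf0, hfcs, hf01⟩ := exists_continuous_one_zero_of_isCompact hK₁ hU.isClosed_compl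
    (disjoint_compl_right_iff_subset.2 hK₁U)
  obtain ⟨g, hg1, hg0, hgcs, hg01⟩ := exists_continuous_one_zero_of_isCompact hK₂ hVc
    (disjoint_compl_right_iff_subset.2 hK₂R)
  set h : V3 × V3 → ℝ := fun p => f p.1 * g p.2 with hh
  have hhc : Continuous h := (f.continuous.comp continuous_fst).mul (g.continuous.comp continuous_snd)
  have hhcs : HasCompactSupport h := by
    refine HasCompactSupport.intro (hfcs.isCompact.prod hgcs.isCompact) ?_
    rintro ⟨y, v⟩ hp
    rw [Set.mem_prod, not_and_or] at hp
    rcases hp with hy | hv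
    · simp only [hh, image_eq_zero_of_notMem_tsupport hy, zero_mul]
    · simp only [hh, image_eq_zero_of_notMem_tsupport hv, mul_zero]
  have hh0 : ∀ p, 0 ≤ h p := fun p => mul_nonneg (hf01 p.1).1 (hg01 p.2).1
  have hle : ∀ p, h p ≤ f p.1 * ({v : V3 | R < ‖v‖}).indicator (fun _ => (1 : ℝ)) p.2 := by
    intro p
    refine mul_le_mul_of_nonneg_left ?_ (hf01 p.1).1
    by_cases hv : p.2 ∈ {v : V3 | R < ‖v‖}
    · rw [indicator_of_mem hv]
      exact (hg01 p.2).2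
    · rw [indicator_of_notMem hv]
      exact (hg0 hv).le
  have hK1 : ∀ p ∈ K₁ ×ˢ K₂, 1 ≤ h p := fun p hp => by
    simp only [hh, hf1 hp.1, hg1 hp.2, Pi.one_apply, mul_one, le_refl]
  obtain ⟨hint, hlim⟩ := hone h hhc hhcs hh0
  have hI : ∫ ω, ω.sumFn h ∂μ ≤ (∫ x, φ x)⁻¹ * σ ^ 3 * δ * ∫ y, f y :=
    integral_sumFn_le_campbell hσ hφ hφ0 hφ1 hφi Q hQ ι μ hhc.measurable hh0 hlim f.continuous hfcs
      (fun y => (hf01 y).1) hle htail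
  have hc0 : 0 ≤ (∫ x, φ x)⁻¹ * σ ^ 3 * δ := mul_nonneg (mul_nonneg (inv_nonneg.2 hφi.le) (pow_nonneg hσ.le 3)) hδ
  have hfi : Integrable (fun y => f y) volume := f.continuous.integrable_of_hasCompactSupport hfcs
  have hfvol : ENNReal.ofReal (∫ y, f y) ≤ volume U := by
    rw [ofReal_integral_eq_lintegral_ofReal hfi (ae_of_all _ fun y => (hf01 y).1), ← lintegral_indicator_one
      hU.measurableSet]
    refine lintegral_mono fun y => ?_
    by_cases hy : y ∈ U
    · rw [indicator_of_mem hy, Pi.one_apply]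
      exact ENNReal.ofReal_le_one.2 (hf01 y).2
    · rw [indicator_of_notMem hy, hf0 hy, Pi.zero_apply, ENNReal.ofReal_zero]
  calc ∫⁻ ω, ((ω.count (K₁ ×ˢ K₂) : ℕ∞) : ℝ≥0∞) ∂μ ≤ ∫⁻ ω, ENNReal.ofReal (ω.sumFn h) ∂μ :=
        lintegral_mono fun ω => toENNReal_count_le_ofReal_sumFn ω (hK₁.prod hK₂) hhcs hh0 hK1
    _ = ENNReal.ofReal (∫ ω, ω.sumFn h ∂μ) :=
        (ofReal_integral_eq_lintegral_ofReal hint (ae_of_all _ fun ω => ω.sumFn_nonneg hh0)).symm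
    _ ≤ ENNReal.ofReal ((∫ x, φ x)⁻¹ * σ ^ 3 * δ * ∫ y, f y) := ENNReal.ofReal_le_ofReal hI
    _ = ENNReal.ofReal ((∫ x, φ x)⁻¹ * σ ^ 3 * δ) * ENNReal.ofReal (∫ y, f y) := ENNReal.ofReal_mul hc0
    _ ≤ ENNReal.ofReal ((∫ x, φ x)⁻¹ * σ ^ 3 * δ) * volume U := by gcongr

/-- **Campbell bound on open boxes.** Under the one-body limit on `C_c⁺` and the velocity-tail hypothesis, for open
`U ⊆ ℝ³`: `E_μ[#{p ∈ ω : p.1 ∈ U, R < ‖p.2‖}] ≤ (∫φ)⁻¹ σ³ δ · vol(U)` (monotone convergence along compact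
exhaustions of `U` and of `{R < ‖v‖}`, from `lintegral_count_compact_prod_le_campbell`). -/
theorem lintegral_count_open_prod_le_campbell {σ : ℝ} (hσ : 0 < σ) {φ : T3 → ℝ} (hφ : Continuous φ)
    (hφ0 : ∀ x, 0 ≤ φ x) (hφ1 : ∀ x, φ x ≤ 1) (hφi : 0 < ∫ x, φ x) {N : ℕ → ℕ}
    (Q : ∀ k, Measure (Config (N k + 1) (Fin 3) T3)) (hQ : ∀ k, IsProbabilityMeasure (Q k)) (ι : ℕ → ℕ)
    (μ : Measure (PointConfig (V3 × V3)))
    (hone : ∀ (h : V3 × V3 → ℝ), Continuous h → HasCompactSupport h → (∀ p, 0 ≤ h p) →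
      Integrable (fun ω : PointConfig (V3 × V3) => ω.sumFn h) μ ∧
      Tendsto (fun k => (∫ x, φ x)⁻¹ * ∫ x : T3, φ x *
          ∫ z, (∑ i, h (blowUpPoint (hsDiameter σ (N (ι k))) x (z i))) ∂Q (ι k)) atTop
        (𝓝 (∫ ω, ω.sumFn h ∂μ)))
    {R δ : ℝ} (hδ : 0 ≤ δ)
    (htail : ∀ k, ((N (ι k) + 1 : ℕ) : ℝ)⁻¹ *
      ∫ z, (∑ i, ({v : V3 | R < ‖v‖}).indicator (fun _ => (1 : ℝ)) (z i).2) ∂Q (ι k) ≤ δ)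
    {U : Set V3} (hU : IsOpen U) :
    ∫⁻ ω, ((ω.count (U ×ˢ {v : V3 | R < ‖v‖}) : ℕ∞) : ℝ≥0∞) ∂μ ≤
      ENNReal.ofReal ((∫ x, φ x)⁻¹ * σ ^ 3 * δ) * volume U := by
  have hVo : IsOpen {v : V3 | R < ‖v‖} := isOpen_lt continuous_const continuous_norm
  obtain ⟨F, hFc, hFU, hFun, hFmono⟩ := hU.exists_iUnion_isClosed
  obtain ⟨G, hGc, hGV, hGun, hGmono⟩ := hVo.exists_iUnion_isClosed
  have hAm : ∀ n : ℕ, MeasurableSet ((F n ∩ Metric.closedBall (0 : V3) n) ×ˢ (G n ∩ Metric.closedBall (0 : V3) n)) :=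
    fun n => ((hFc n).inter Metric.isClosed_closedBall).measurableSet.prod
      ((hGc n).inter Metric.isClosed_closedBall).measurableSet
  have hAmono : Monotone fun n : ℕ => (F n ∩ Metric.closedBall (0 : V3) n) ×ˢ (G n ∩ Metric.closedBall (0 : V3) n) :=
    fun m n hmn => Set.prod_mono (monotone_inter_closedBall hFmono hmn) (monotone_inter_closedBall hGmono hmn)
  have hAU : (⋃ n : ℕ, (F n ∩ Metric.closedBall (0 : V3) n) ×ˢ (G n ∩ Metric.closedBall (0 : V3) n)) =
      U ×ˢ {v : V3 | R < ‖v‖} := by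
    rw [iUnion_prod_of_monotone (monotone_inter_closedBall hFmono) (monotone_inter_closedBall hGmono),
      iUnion_inter_closedBall_eq hFmono, iUnion_inter_closedBall_eq hGmono, hFun, hGun]
  rw [← hAU, lintegral_count_iUnion_campbell μ hAm hAmono]
  refine iSup_le fun n => ?_
  exact lintegral_count_compact_prod_le_campbell hσ hφ hφ0 hφ1 hφi Q hQ ι μ hone hδ htail
    ((isCompact_closedBall (0 : V3) n).inter_left (hFc n)) hU (inter_subset_left.trans (hFU n))
    ((isCompact_closedBall (0 : V3) n).inter_left (hGc n)) (inter_subset_left.trans (hGV n))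

/-- **The Campbell (intensity) bound of a tangent state** (registered stub `stub_campbellBound` of line `FirstLemma`,
crux stmt-AtomisticToContinuum-14135; OVY 1993 §4 (A)). Along a tangent state `μ` of a tangent family for which the
one-body limit holds on `C_c⁺` (hypothesis), if the laws `Q (ι k)` put normalised mass `≤ δ` on velocities of norm
`> R`, uniformly in `k`, then for every measurable `S ⊆ ℝ³`:
`E_μ[#{p ∈ ω : p.1 ∈ S, R < ‖p.2‖}] ≤ (∫φ)⁻¹ σ³ δ · vol(S)` (open `S`: `lintegral_count_open_prod_le_campbell`;
general `S`: outer regularity of Lebesgue measure). -/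
theorem stub_campbellBound : ∀ (σ a θ : ℝ) (u₀ : V3) (κ : ℝ), 0 < σ →
      ∀ (φ : T3 → ℝ), Continuous φ → (∀ x, 0 ≤ φ x) → (∀ x, φ x ≤ 1) → 0 < ∫ x, φ x →
      ∀ (N : ℕ → ℕ)
        (Φ : ∀ k, HardSphereFlow (Literature.Analysis.FluidPDE.Torus.geometry (Fin 3)) (hsDiameter σ (N k)) (N k + 1))
        (Q : ∀ k, Measure (Config (N k + 1) (Fin 3) T3)),
        IsTangentFamily σ a θ u₀ κ N Φ Q →
        ∀ (ι : ℕ → ℕ) (μ : Measure (PointConfig (V3 × V3))), IsTangentState σ φ N Q ι μ →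
        (∀ (h : V3 × V3 → ℝ), Continuous h → HasCompactSupport h → (∀ p, 0 ≤ h p) →
          Integrable (fun ω : PointConfig (V3 × V3) => ω.sumFn h) μ ∧
          Tendsto (fun k => (∫ x, φ x)⁻¹ * ∫ x : T3, φ x *
              ∫ z, (∑ i, h (blowUpPoint (hsDiameter σ (N (ι k))) x (z i))) ∂Q (ι k)) atTop
            (𝓝 (∫ ω, ω.sumFn h ∂μ))) →
        ∀ (R δ : ℝ), 0 ≤ δ →
          (∀ k, ((N (ι k) + 1 : ℕ) : ℝ)⁻¹ *
            ∫ z, (∑ i, ({v : V3 | R < ‖v‖}).indicator (fun _ => (1 : ℝ)) (z i).2) ∂Q (ι k) ≤ δ) →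
        ∀ (S : Set V3), MeasurableSet S →
          ∫⁻ ω, ((ω.count (S ×ˢ {v : V3 | R < ‖v‖}) : ℕ∞) : ℝ≥0∞) ∂μ ≤
            ENNReal.ofReal ((∫ x, φ x)⁻¹ * σ ^ 3 * δ) * volume S := by
  intro σ a θ u₀ κ hσ φ hφ hφ0 hφ1 hφi N Φ Q hfam ι μ _hμ hone R δ hδ htail S _hS
  have hQ : ∀ k, IsProbabilityMeasure (Q k) := hfam.2.1
  have hopen : ∀ U : Set V3, IsOpen U → ∫⁻ ω, ((ω.count (U ×ˢ {v : V3 | R < ‖v‖}) : ℕ∞) : ℝ≥0∞) ∂μ ≤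
      ENNReal.ofReal ((∫ x, φ x)⁻¹ * σ ^ 3 * δ) * volume U := fun U hU =>
    lintegral_count_open_prod_le_campbell hσ hφ hφ0 hφ1 hφi Q hQ ι μ hone hδ htail hU
  have hmono : ∀ {T U : Set V3}, T ⊆ U → ∫⁻ ω, ((ω.count (T ×ˢ {v : V3 | R < ‖v‖}) : ℕ∞) : ℝ≥0∞) ∂μ ≤
      ∫⁻ ω, ((ω.count (U ×ˢ {v : V3 | R < ‖v‖}) : ℕ∞) : ℝ≥0∞) ∂μ := fun hTU =>
    lintegral_mono fun ω => ENat.toENNReal_le.2 (ω.count_mono (prod_mono hTU Subset.rfl))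
  refine le_of_forall_gt_imp_ge_of_dense fun r hr => ?_
  obtain ⟨U, hSU, hUo, hUr⟩ : ∃ U : Set V3, S ⊆ U ∧ IsOpen U ∧
      ENNReal.ofReal ((∫ x, φ x)⁻¹ * σ ^ 3 * δ) * volume U < r := by
    by_cases hC : ENNReal.ofReal ((∫ x, φ x)⁻¹ * σ ^ 3 * δ) = 0
    · refine ⟨univ, subset_univ _, isOpen_univ, ?_⟩
      rw [hC, zero_mul]
      exact lt_of_le_of_lt bot_le hr
    · have hCt : ENNReal.ofReal ((∫ x, φ x)⁻¹ * σ ^ 3 * δ) ≠ ⊤ := ENNReal.ofReal_ne_top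
      have h1 : volume S < r / ENNReal.ofReal ((∫ x, φ x)⁻¹ * σ ^ 3 * δ) := by
        rw [ENNReal.lt_div_iff_mul_lt (Or.inl hC) (Or.inl hCt), mul_comm]
        exact hr
      obtain ⟨U, hUS, hUo, hU⟩ := Set.exists_isOpen_lt_of_lt S _ h1
      refine ⟨U, hUS, hUo, ?_⟩
      rw [ENNReal.lt_div_iff_mul_lt (Or.inl hC) (Or.inl hCt), mul_comm] at hU
      exact hU
  exact (hmono hSU).trans ((hopen U hUo).trans hUr.le)

end Summit.AtomisticToContinuum.HydrodynamicLimit.Theorems.KiferCompactification
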